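import Literature.NumberTheory.DiophantineGeometry.XYZConjecture
import Literature.NumberTheory.DiophantineGeometry.XYZConjectureABCExponent
import Literature.NumberTheory.DiophantineGeometry.AbcWave0SUnitProofs
import Literature.NumberTheory.LFunctions.RHWave0PNTProofs
import HarnessLib

/-!
# Lagarias–Soundararajan, Theorems 1.1, 2.1, 2.2, 1.3: what abc, Stewart–Yu and GRH give for `xyz`

Topic `NumberTheory/DiophantineGeometry`; the PROOF companion of `XYZConjecture.lean` (the xyz
conjecture record: `XYZ.smoothness`, `XYZ.ExponentGE`/`XYZ.ExponentLE`, `XYZLowerHalf`, …) and of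
`XYZConjectureABCExponent.lean` (`ABCExponentBound κ₁`, the weak abc conjecture with exponent
`κ₁`). Everything in this file is PROVED; no definition, no named fact.

Source: J. C. Lagarias, K. Soundararajan, *Smooth solutions to the abc equation: the xyz
conjecture*, J. Théor. Nombres Bordeaux 23 (2011) 209–234 [LagariasSoundararajan2011]
(= arXiv:0911.4147, numbering followed; READ §1.4 and §2):

* `ABCExponentBound.finite_smoothness_le_mul_log` — **Thm. 2.1**: weak abc with exponent `κ₁` ⟹
  for every `ε > 0` only finitely many abc triples have `S ≤ (κ₁ - ε) log c`;
* `ABCExponentBound.exponentGE` — **Thm. 1.1**: hence property (a) at `κ₁`, "`κ₀ ≥ κ₁`"; with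
  strong abc in the tree's dress, `exponentGE_one_of_abcQualityForm` (`κ₀ ≥ 1`) and
  `xyzLowerHalf_of_abcQualityForm` (abc ⟹ the route target `XYZLowerBound` of
  `ABC/BelyiDegreeSmooth`, via `xyzLowerHalf_iff`);
* `finite_smoothness_le_mul_loglog` — **Thm. 2.2**: from Stewart–Yu 2001 (`stewart_yu`, named fact
  abc.S06 of `AbcWave0`, taken as a hypothesis) only finitely many abc triples have
  `S ≤ (3 - ε) log log c`;
* `xyzConjecture_of_abc_of_grh` — **Thm. 1.3** ("alphabet soup"): weak abc + GRH ⟹ weak xyz, with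
  Thm. 1.2 (GRH ⟹ (b) at `8`, a deep circle-method theorem proved in the authors' Proc. LMS 104
  (2012) paper and NOT vendored) carried as an explicit hypothesis.

The two analytic inputs of the printed proofs are theorems of the tree: the prime number theorem
`θ(x) ~ x` (`Literature.NumberTheory.LFunctions.chebyshevTheta_isEquivalent`, giving
`∏_{p ≤ y} p = e^{y + o(y)}`, here `exists_theta_le_mul`) and the `S`-unit theorem over `ℚ`
(`finite_setOf_isABCTriple_primeFactors_subset_holds`, Mahler 1933: finitely many abc triples
with all prime factors below a bound — the step "there are only finitely many ABC solutions having
`S` taking a given value" of the proof of Thm. 2.2, used here also in Thm. 2.1, where the source's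
`o(1)` is as `S → ∞`).

## References

* [LagariasSoundararajan2011] Lagarias–Soundararajan, JTNB 23 (2011), doi:10.5802/jtnb.757,
  arXiv:0911.4147 — Thm. 1.1, Thm. 1.3 (§1.4), Thm. 2.1, Thm. 2.2 (§2).
* [StewartYu2001] C. L. Stewart, Kunrui Yu, *On the abc conjecture II*, Duke Math. J. 108 (2001),
  Thm. 1.
* [MontgomeryVaughan2007] Montgomery–Vaughan, *Multiplicative Number Theory I*, §8.1 (`θ(x) ~ x`).
-/

noncomputable section

open Real Filter Asymptotics UniqueFactorizationMonoid

namespace Literature.NumberTheory.DiophantineGeometry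

/-! ### `rad(abc) ≤ e^{θ(S)}` and the prime number theorem input -/

/-- `rad(abc) ≤ ∏_{p ≤ S(a,b,c)} p`: the radical is the product of the distinct primes of `abc`,
all of which are `≤ S` [LagariasSoundararajan2011, (2.1)]. [cite: LagariasSoundararajan2011, §2 (2.1)] -/
theorem XYZ.rad_dvd_primorial (a b c : ℕ) : rad a b c ∣ primorial (XYZ.smoothness a b c) := by
  rw [rad_def, Nat.radical_eq_prod_primeFactors, primorial]
  refine Finset.prod_dvd_prod_of_subset _ _ _ fun p hp => ?_
  exact Finset.mem_filter.mpr ⟨Finset.mem_range.mpr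
    (Nat.lt_succ_of_le (XYZ.le_smoothness_of_mem_primeFactors hp)), Nat.prime_of_mem_primeFactors hp⟩

/-- `log rad(abc) ≤ θ(S(a, b, c))` (Chebyshev's `θ = log ∏_{p ≤ x} p`). [cite: LagariasSoundararajan2011, §2 (2.1)] -/
theorem XYZ.log_rad_le_theta (a b c : ℕ) :
    Real.log (rad a b c) ≤ Chebyshev.theta (XYZ.smoothness a b c) := by
  rw [Chebyshev.theta_eq_log_primorial, Nat.floor_natCast]
  have h0 : (0 : ℝ) < rad a b c := by exact_mod_cast Nat.radical_pos _
  exact Real.log_le_log h0 (by exact_mod_cast Nat.le_of_dvd (primorial_pos _) (XYZ.rad_dvd_primorial a b c))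

/-- The prime number theorem in the form used: `∏_{p ≤ y} p = e^{y + o(y)}`, i.e. for `δ > 0`,
`θ(x) ≤ (1 + δ) x` for `x ≥ X₀(δ)` — from `θ(x) ~ x`
(`Literature.NumberTheory.LFunctions.chebyshevTheta_isEquivalent`, PROVED in the tree).
[cite: LagariasSoundararajan2011, §2 (proof of Thm. 2.1)] -/
theorem exists_theta_le_mul {δ : ℝ} (hδ : 0 < δ) :
    ∃ X₀ : ℝ, ∀ x : ℝ, X₀ ≤ x → Chebyshev.theta x ≤ (1 + δ) * x := by
  have h := (Literature.NumberTheory.LFunctions.chebyshevTheta_isEquivalent).isLittleO.bound hδ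
  obtain ⟨X₀, hX₀⟩ := Filter.eventually_atTop.mp h
  refine ⟨max X₀ 0, fun x hx => ?_⟩
  have hx0 : 0 ≤ x := le_of_max_le_right hx
  have h1 := hX₀ x (le_of_max_le_left hx)
  simp only [Pi.sub_apply, Real.norm_eq_abs, abs_of_nonneg hx0] at h1
  have h2 := (abs_le.mp h1).2
  linarith

/-! ### Theorem 2.1 / Theorem 1.1: abc with exponent `κ₁` gives `κ₀ ≥ κ₁` -/

/-- **Lagarias–Soundararajan, Thm. 2.1.** *Assume the weak abc conjecture with exponent `κ₁`.
Then for any `ε > 0` there are only finitely many primitive solutions with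
`S(X, Y, Z) ≤ (κ₁ - ε) log H(X, Y, Z)`.* Proof as printed: `R ≤ ∏_{p ≤ S} p = e^{S(1+o(1))}`
(prime number theorem) `≤ H^{κ₁ - ε + o(1)} ≤ H^{κ₁ - ε/2}` for `S` large, and abc; the solutions
with `S` bounded are finitely many by the `S`-unit theorem
(`finite_setOf_isABCTriple_primeFactors_subset_holds`, Mahler 1933, PROVED in the tree).
[cite: LagariasSoundararajan2011, Thm. 2.1] -/
theorem ABCExponentBound.finite_smoothness_le_mul_log {κ₁ : ℝ} (h : ABCExponentBound κ₁) {ε : ℝ}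
    (hε : 0 < ε) :
    {t : ℕ × ℕ × ℕ | IsABCTriple t.1 t.2.1 t.2.2 ∧
      (XYZ.smoothness t.1 t.2.1 t.2.2 : ℝ) ≤ (κ₁ - ε) * Real.log t.2.2}.Finite := by
  -- the PNT slack `δ` with `δ (κ₁ - ε) ≤ ε / 2`
  set δ : ℝ := ε / (2 * (|κ₁| + ε + 1)) with hδ
  have hδ0 : 0 < δ := by rw [hδ]; positivity
  have hδκ : δ * (κ₁ - ε) ≤ ε / 2 := by
    rcases le_or_gt (κ₁ - ε) 0 with hle | hlt
    · exact (mul_nonpos_of_nonneg_of_nonpos hδ0.le hle).trans (by positivity)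
    · calc δ * (κ₁ - ε) ≤ δ * (|κ₁| + ε + 1) :=
            mul_le_mul_of_nonneg_left (by linarith [le_abs_self κ₁]) hδ0.le
        _ = ε / 2 := by rw [hδ]; field_simp
  obtain ⟨X₀, hX₀⟩ := exists_theta_le_mul hδ0
  refine ((finite_setOf_isABCTriple_primeFactors_subset_holds (Finset.range ⌈X₀⌉₊)).union
    (h (ε / 2) (half_pos hε))).subset ?_
  rintro ⟨a, b, c⟩ ⟨ht, hS⟩
  dsimp only at ht hS ⊢
  by_cases hsmall : XYZ.smoothness a b c < ⌈X₀⌉₊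
  · exact Or.inl ⟨ht, fun p hp =>
      Finset.mem_range.mpr (lt_of_le_of_lt (XYZ.le_smoothness_of_mem_primeFactors hp) hsmall)⟩
  · refine Or.inr ⟨ht, ?_⟩
    push Not at hsmall
    have hSX : X₀ ≤ (XYZ.smoothness a b c : ℝ) := (Nat.le_ceil X₀).trans (by exact_mod_cast hsmall)
    have hc0 : (0 : ℝ) < c := by exact_mod_cast lt_of_lt_of_le zero_lt_two ht.two_le
    have hlog0 : 0 ≤ Real.log c := Real.log_nonneg (by exact_mod_cast le_trans one_le_two ht.two_le)
    have hR0 : (0 : ℝ) < rad a b c := by exact_mod_cast Nat.radical_pos _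
    have hlogR : Real.log (rad a b c) ≤ (κ₁ - ε / 2) * Real.log c := by
      calc Real.log (rad a b c) ≤ Chebyshev.theta (XYZ.smoothness a b c) := XYZ.log_rad_le_theta a b c
        _ ≤ (1 + δ) * XYZ.smoothness a b c := hX₀ _ hSX
        _ ≤ (1 + δ) * ((κ₁ - ε) * Real.log c) := mul_le_mul_of_nonneg_left hS (by positivity)
        _ = (κ₁ - ε) * Real.log c + δ * (κ₁ - ε) * Real.log c := by ring
        _ ≤ (κ₁ - ε) * Real.log c + ε / 2 * Real.log c :=
            add_le_add le_rfl (mul_le_mul_of_nonneg_right hδκ hlog0)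
        _ = (κ₁ - ε / 2) * Real.log c := by ring
    calc ((rad a b c : ℕ) : ℝ) = Real.exp (Real.log (rad a b c)) := (Real.exp_log hR0).symm
      _ ≤ Real.exp ((κ₁ - ε / 2) * Real.log c) := Real.exp_le_exp.mpr hlogR
      _ = (c : ℝ) ^ (κ₁ - ε / 2) := by rw [Real.rpow_def_of_pos hc0, mul_comm]

/-- **Lagarias–Soundararajan, Thm. 1.1** (`κ₀ ≥ κ₁`). *If the weak form of the abc conjecture
holds with exponent `κ₁`, then for each `ε > 0` there are only finitely many primitive solutions
with `S(X, Y, Z) < (log H(X, Y, Z))^{κ₁ - ε}`; thus `κ₀ ≥ κ₁`.* From Thm. 2.1, since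
`(log H)^{κ₁ - ε} ≤ (κ₁ - ε/2) log H` for `H` large when `κ₁ - ε < 1`; for `κ₁ > 1 + ε/2` the
hypothesis is contradictory (`not_abcExponentBound_of_one_lt`). [cite: LagariasSoundararajan2011, Thm. 1.1] -/
theorem ABCExponentBound.exponentGE {κ₁ : ℝ} (h : ABCExponentBound κ₁) : XYZ.ExponentGE κ₁ := by
  intro ε hε
  by_cases hbig : 1 + ε / 2 < κ₁
  · exact absurd h (not_abcExponentBound_of_one_lt (by linarith))
  push Not at hbig
  have hF := h.finite_smoothness_le_mul_log (half_pos hε)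
  rcases le_or_gt (κ₁ - ε / 2) 0 with hneg | hpos
  · -- `κ₁ - ε < 0`: for `c ≥ 3`, `(log c)^{κ₁ - ε} ≤ 1 < 2 ≤ S`
    refine (finite_isABCTriple_of_le_real 2).subset ?_
    rintro ⟨a, b, c⟩ ⟨ht, hlt⟩
    dsimp only at ht hlt ⊢
    refine ⟨ht, ?_⟩
    by_contra hc
    push Not at hc
    have hc2 : 2 < c := by exact_mod_cast hc
    have hlog1 := one_lt_log_of_three_le (show 3 ≤ c by omega)
    have h1 : Real.log c ^ (κ₁ - ε) ≤ 1 :=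
      Real.rpow_le_one_of_one_le_of_nonpos hlog1.le (by linarith)
    have h2 : (2 : ℝ) ≤ XYZ.smoothness a b c := by exact_mod_cast XYZ.two_le_smoothness ht
    linarith
  · set m : ℝ := κ₁ - ε / 2 with hm
    set r : ℝ := κ₁ - ε - 1 with hr
    have hr0 : r < 0 := by rw [hr]; linarith
    set L₀ : ℝ := max 1 (m ^ (1 / r)) with hL₀
    refine (hF.union (finite_isABCTriple_of_le_real (Real.exp L₀))).subset ?_
    rintro ⟨a, b, c⟩ ⟨ht, hlt⟩
    dsimp only at ht hlt ⊢
    by_cases hc : (c : ℝ) ≤ Real.exp L₀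
    · exact Or.inr ⟨ht, hc⟩
    · refine Or.inl ⟨ht, ?_⟩
      push Not at hc
      have hc0 : (0 : ℝ) < c := (Real.exp_pos _).trans hc
      have hlogc : L₀ < Real.log c := by rwa [Real.lt_log_iff_exp_lt hc0]
      have hlog1 : 1 ≤ Real.log c := (le_max_left _ _).trans hlogc.le
      have hlog0 : 0 < Real.log c := by linarith
      have hbase : m ^ (1 / r) ≤ Real.log c := (le_max_right _ _).trans hlogc.le
      have hmr : 0 < m ^ (1 / r) := Real.rpow_pos_of_pos hpos _
      have hpow : Real.log c ^ r ≤ m := by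
        calc Real.log c ^ r ≤ (m ^ (1 / r)) ^ r := Real.rpow_le_rpow_of_nonpos hmr hbase hr0.le
          _ = m := by rw [← Real.rpow_mul hpos.le, one_div, inv_mul_cancel₀ hr0.ne, Real.rpow_one]
      calc (XYZ.smoothness a b c : ℝ) ≤ Real.log c ^ (κ₁ - ε) := hlt.le
        _ = Real.log c ^ r * Real.log c := by
            rw [show κ₁ - ε = r + 1 by rw [hr]; ring, Real.rpow_add hlog0, Real.rpow_one]
        _ ≤ m * Real.log c := mul_le_mul_of_nonneg_right hpow hlog0.le

/-- **Strong abc ⟹ `κ₀ ≥ 1`** [LagariasSoundararajan2011, Thm. 1.1, second sentence], with strong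
abc in the tree's dress `ABCQualityForm`. [cite: LagariasSoundararajan2011, Thm. 1.1] -/
theorem exponentGE_one_of_abcQualityForm (h : ABCQualityForm) : XYZ.ExponentGE 1 :=
  (abcExponentBound_one_iff_abcQualityForm.mpr h).exponentGE

/-- The abc conjecture (quality form) implies the positivity half of the xyz conjecture, i.e. the
route target `XYZLowerBound` (via `xyzLowerHalf_iff`). [cite: LagariasSoundararajan2011, Thm. 1.1] -/
theorem xyzLowerHalf_of_abcQualityForm (h : ABCQualityForm) : XYZLowerHalf :=
  (exponentGE_one_of_abcQualityForm h).xyzLowerHalf one_pos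

/-! ### Theorem 2.2: the unconditional lower bound `S > (3 - ε) log log H` from Stewart–Yu -/

/-- **Lagarias–Soundararajan, Thm. 2.2** (from Stewart–Yu 2001, `stewart_yu`, a named fact of
`AbcWave0` — Baker's theory, not discharged). *For each `ε > 0` there are only finitely many
primitive solutions with `S(X, Y, Z) ≤ (3 - ε) log log H(X, Y, Z)`.* Proof as printed:
solutions with bounded `S` are finitely many (`S`-unit theorem); for `S` large,
`R ≤ e^{S(1 + ε/6)} ≤ (log H)^{3 - ε/2}`, and Stewart–Yu's `log H ≤ C R^{1/3} (log R)^3` becomes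
`log H ≤ C (log H)^{1 - ε/6} (3 log log H)^3`, false for `H` large. [cite: LagariasSoundararajan2011, Thm. 2.2] -/
theorem finite_smoothness_le_mul_loglog (hSY : stewart_yu) {ε : ℝ} (hε : 0 < ε) :
    {t : ℕ × ℕ × ℕ | IsABCTriple t.1 t.2.1 t.2.2 ∧
      (XYZ.smoothness t.1 t.2.1 t.2.2 : ℝ) ≤ (3 - ε) * Real.log (Real.log t.2.2)}.Finite := by
  rcases le_or_gt 3 ε with hε3 | hε3
  · -- `3 - ε ≤ 0`: only `c ≤ 2` can occur
    refine (finite_isABCTriple_of_le_real 2).subset ?_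
    rintro ⟨a, b, c⟩ ⟨ht, hS⟩
    dsimp only at ht hS ⊢
    refine ⟨ht, ?_⟩
    by_contra hc
    push Not at hc
    have hc2 : 2 < c := by exact_mod_cast hc
    have hll : 0 < Real.log (Real.log c) := Real.log_pos (one_lt_log_of_three_le (by omega))
    have h2 : (2 : ℝ) ≤ XYZ.smoothness a b c := by exact_mod_cast XYZ.two_le_smoothness ht
    have : (3 - ε) * Real.log (Real.log c) ≤ 0 := mul_nonpos_of_nonpos_of_nonneg (by linarith) hll.le
    linarith
  obtain ⟨C, hC⟩ := hSY
  -- constants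
  set δ : ℝ := ε / 6 with hδ
  have hδ0 : 0 < δ := by positivity
  set μ : ℝ := (1 + δ) * (3 - ε) with hμ
  have h3ε : 0 < 3 - ε := by linarith
  have hμ0 : 0 < μ := mul_pos (by linarith) h3ε
  have hμ3 : μ ≤ 3 - ε / 2 := by rw [hμ, hδ]; nlinarith [sq_nonneg ε]
  set s : ℝ := 1 - μ / 3 with hs
  have hs0 : 0 < s := by rw [hs]; linarith
  set K : ℝ := max C 0 * μ ^ 3 with hK
  have hK0 : 0 ≤ K := by positivity
  obtain ⟨X₀, hX₀⟩ := exists_theta_le_mul hδ0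
  -- `(log L)^3 ≤ L^s / (K + 1)` for `L ≥ L₁`
  have hlo := (isLittleO_log_rpow_rpow_atTop (3 : ℝ) hs0).bound (show (0 : ℝ) < 1 / (K + 1) by positivity)
  obtain ⟨L₁, hL₁⟩ := Filter.eventually_atTop.mp hlo
  set L₀ : ℝ := max L₁ 1 with hL₀
  refine ((finite_setOf_isABCTriple_primeFactors_subset_holds (Finset.range ⌈X₀⌉₊)).union
    (finite_isABCTriple_of_le_real (Real.exp L₀))).subset ?_
  rintro ⟨a, b, c⟩ ⟨ht, hS⟩
  dsimp only at ht hS ⊢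
  by_cases hsmall : XYZ.smoothness a b c < ⌈X₀⌉₊
  · exact Or.inl ⟨ht, fun p hp =>
      Finset.mem_range.mpr (lt_of_le_of_lt (XYZ.le_smoothness_of_mem_primeFactors hp) hsmall)⟩
  refine Or.inr ⟨ht, ?_⟩
  push Not at hsmall
  by_contra hc
  push Not at hc
  -- now `S ≥ X₀` and `log c > L₀ ≥ 1`: derive a contradiction
  have hc0 : (0 : ℝ) < c := (Real.exp_pos _).trans hc
  have hlogc : L₀ < Real.log c := by rwa [Real.lt_log_iff_exp_lt hc0]
  have hL1 : 1 ≤ Real.log c := (le_max_right _ _).trans hlogc.le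
  have hL0 : 0 < Real.log c := by linarith
  have hSX : X₀ ≤ (XYZ.smoothness a b c : ℝ) := (Nat.le_ceil X₀).trans (by exact_mod_cast hsmall)
  have h2S : (2 : ℝ) ≤ XYZ.smoothness a b c := by exact_mod_cast XYZ.two_le_smoothness ht
  -- `log log c > 0` from `2 ≤ S ≤ (3 - ε) log log c`
  have hll0 : 0 < Real.log (Real.log c) := by
    by_contra hll
    push Not at hll
    have : (3 - ε) * Real.log (Real.log c) ≤ 0 := mul_nonpos_of_nonneg_of_nonpos h3ε.le hll
    linarith
  -- `log R ≤ μ log log c`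
  have hR0 : (0 : ℝ) < rad a b c := by exact_mod_cast Nat.radical_pos _
  have hR2 : (2 : ℝ) ≤ rad a b c := by exact_mod_cast ht.two_le_rad
  have hlogR0 : 0 ≤ Real.log (rad a b c) := Real.log_nonneg (by linarith)
  have hlogR : Real.log (rad a b c) ≤ μ * Real.log (Real.log c) := by
    calc Real.log (rad a b c) ≤ Chebyshev.theta (XYZ.smoothness a b c) := XYZ.log_rad_le_theta a b c
      _ ≤ (1 + δ) * XYZ.smoothness a b c := hX₀ _ hSX
      _ ≤ (1 + δ) * ((3 - ε) * Real.log (Real.log c)) := mul_le_mul_of_nonneg_left hS (by positivity)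
      _ = μ * Real.log (Real.log c) := by rw [hμ]; ring
  -- Stewart–Yu: `log c ≤ C R^{1/3} (log R)^3 ≤ K (log c)^{μ/3} (log log c)^3`
  have hR13 : (rad a b c : ℝ) ^ (1 / 3 : ℝ) ≤ Real.log c ^ (μ / 3) := by
    calc (rad a b c : ℝ) ^ (1 / 3 : ℝ) = Real.exp (Real.log (rad a b c) * (1 / 3)) :=
          Real.rpow_def_of_pos hR0 _
      _ ≤ Real.exp (μ * Real.log (Real.log c) * (1 / 3)) :=
          Real.exp_le_exp.mpr (mul_le_mul_of_nonneg_right hlogR (by norm_num))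
      _ = Real.log c ^ (μ / 3) := by
          rw [Real.rpow_def_of_pos hL0]; congr 1; ring
  have hlogR3 : Real.log (rad a b c) ^ 3 ≤ (μ * Real.log (Real.log c)) ^ 3 :=
    pow_le_pow_left₀ hlogR0 hlogR 3
  have hSY : Real.log c ≤ K * Real.log c ^ (μ / 3) * Real.log (Real.log c) ^ 3 := by
    calc Real.log c ≤ C * (rad a b c : ℝ) ^ (1 / 3 : ℝ) * Real.log (rad a b c : ℕ) ^ 3 := hC a b c ht
      _ ≤ max C 0 * (rad a b c : ℝ) ^ (1 / 3 : ℝ) * Real.log (rad a b c : ℕ) ^ 3 :=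
          mul_le_mul_of_nonneg_right
            (mul_le_mul_of_nonneg_right (le_max_left C 0) (by positivity)) (pow_nonneg hlogR0 3)
      _ ≤ max C 0 * Real.log c ^ (μ / 3) * (μ * Real.log (Real.log c)) ^ 3 :=
          mul_le_mul (mul_le_mul_of_nonneg_left hR13 (le_max_right _ _)) hlogR3
            (pow_nonneg hlogR0 3) (mul_nonneg (le_max_right _ _) (Real.rpow_nonneg hL0.le _))
      _ = K * Real.log c ^ (μ / 3) * Real.log (Real.log c) ^ 3 := by rw [hK]; ring
  -- little-o at `L = log c ≥ L₁`: `(log L)^3 ≤ L^s / (K+1)`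
  have hlo1 := hL₁ (Real.log c) ((le_max_left _ _).trans hlogc.le)
  have hll3 : Real.log (Real.log c) ^ (3 : ℝ) = Real.log (Real.log c) ^ (3 : ℕ) := by
    rw [show (3 : ℝ) = ((3 : ℕ) : ℝ) by norm_num, Real.rpow_natCast]
  rw [hll3, Real.norm_of_nonneg (pow_nonneg hll0.le 3),
    Real.norm_of_nonneg (Real.rpow_nonneg hL0.le s)] at hlo1
  -- combine: `log c ≤ K L^{μ/3} (log L)^3 ≤ K/(K+1) L^{μ/3} L^s = K/(K+1) log c`
  have hsplit : Real.log c ^ (μ / 3) * Real.log c ^ s = Real.log c := by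
    have h1 : μ / 3 + s = 1 := by rw [hs]; ring
    rw [← Real.rpow_add hL0, h1, Real.rpow_one]
  have hfinal : Real.log c ≤ K / (K + 1) * Real.log c := by
    calc Real.log c ≤ K * Real.log c ^ (μ / 3) * Real.log (Real.log c) ^ 3 := hSY
      _ ≤ K * Real.log c ^ (μ / 3) * (1 / (K + 1) * Real.log c ^ s) :=
          mul_le_mul_of_nonneg_left hlo1 (mul_nonneg hK0 (Real.rpow_nonneg hL0.le _))
      _ = K / (K + 1) * (Real.log c ^ (μ / 3) * Real.log c ^ s) := by ring
      _ = K / (K + 1) * Real.log c := by rw [hsplit]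
  have hKlt : K / (K + 1) < 1 := by rw [div_lt_one (by positivity)]; linarith
  have hpos := mul_pos hL0 (sub_pos.mpr hKlt)
  nlinarith

/-! ### Theorem 1.3 (alphabet soup) -/

/-- **Lagarias–Soundararajan, Thm. 1.3 ("Alphabet Soup Theorem").** *The weak form of the abc
conjecture together with GRH implies the weak form of the xyz conjecture.* GRH enters only through
Thm. 1.2 (GRH ⟹ property (b) at `8`), carried as the explicit hypothesis `h12` (a deep
circle-method theorem, not vendored). [cite: LagariasSoundararajan2011, Thm. 1.3] -/
theorem xyzConjecture_of_abc_of_grh {κ₁ : ℝ} (hκ₁ : 0 < κ₁) (habc : ABCExponentBound κ₁)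
    (h12 : Literature.NumberTheory.LFunctions.GeneralizedRiemannHypothesis → XYZ.ExponentLE 8)
    (hgrh : Literature.NumberTheory.LFunctions.GeneralizedRiemannHypothesis) : XYZConjecture :=
  ⟨habc.exponentGE.xyzLowerHalf hκ₁, (h12 hgrh).xyzUpperHalf⟩

end Literature.NumberTheory.DiophantineGeometry

end
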